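import Mathlib
import Summits.Ventures.PercRepro2.SwGlueBlocks
import Summits.Ventures.PercRepro2.SwAllGlueAll

/-!
# The block reduction of row 2′SW-ALL (blind cell PercRepro2, night-4 g6, 2026-08-24;
proofs/NIGHT4-G6.md §3; the rigid form of night-4 g4's `Glue.sw_all_of_noCut`)

`swAll_all_of_noCut`: if the rigid row 2′SW-ALL holds on every finite multigraph WITHOUT a cut
vertex, it holds on every finite multigraph (`LocRows.SwAll_all`).  The frame is g4's
(SwGlueBlocks.lean): a cut vertex (`HasCut`) splits the edges into two sides, `E ≃ E₁ ⊕ E₂`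
(`Equiv.sumCompl`), the rigid row is invariant under relabelling the edges (`swAll_of_equiv`), and on
the glued graph it follows from the two sides (`swAll_glue_of_sides`), which have fewer edges —
strong induction on `Fintype.card E`.  Together with `LocRows.sw_all_of_swAll_all` this reduces the
weight-free base (SW) ⟹ 2′DOM ⟹ (BASE) to the rigid row on the multigraphs without a cut vertex.
-/

namespace Summit.Ventures.PercRepro2

namespace Glue

open Hull LocRows

open scoped Classical

variable {V : Type*}

/-! ## Relabelling the edges -/

section Equiv

variable {E E' : Type*} (ends : E → Sym2 V) (e : E' ≃ E)

/-- Edges inside a set are invariant under relabelling the edges. -/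
lemma mem_within_comp_equiv {S : Set V} (f : E) :
    f ∈ within ends S ↔ e.symm f ∈ within (ends ∘ e) S := by
  simp only [within, Set.mem_setOf_eq, Function.comp, Equiv.apply_symm_apply]

variable [Fintype E] [DecidableEq E] [Fintype E'] [DecidableEq E']

/-- **Row 2′SW-ALL is invariant under relabelling the edges.** -/
theorem swAll_of_equiv {l h o : V} (hs : SwAll (ends ∘ e) l h o) : SwAll ends l h o := by
  obtain ⟨f, hf, hmem⟩ := hs
  have hc : ∀ g : Config E, (g ∘ e) ∘ e.symm = g := fun g => by
    funext x; simp [Function.comp]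
  have hc' : ∀ g : Config E', (g ∘ e.symm) ∘ e = g := fun g => by
    funext x; simp [Function.comp]
  refine ⟨fun x => f ⟨x.1 ∘ e, (mem_tgtU_comp_equiv ends e x.1).1 x.2⟩ ∘ e.symm, ?_, ?_⟩
  · intro x y hxy
    have h1 : f ⟨x.1 ∘ e, (mem_tgtU_comp_equiv ends e x.1).1 x.2⟩ =
        f ⟨y.1 ∘ e, (mem_tgtU_comp_equiv ends e y.1).1 y.2⟩ := by
      have this : (f ⟨x.1 ∘ e, (mem_tgtU_comp_equiv ends e x.1).1 x.2⟩ ∘ e.symm) ∘ e =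
          (f ⟨y.1 ∘ e, (mem_tgtU_comp_equiv ends e y.1).1 y.2⟩ ∘ e.symm) ∘ e :=
        congrArg (fun ζ => ζ ∘ e) hxy
      rwa [hc', hc'] at this
    have h2 : x.1 ∘ e = y.1 ∘ e := congrArg Subtype.val (hf h1)
    apply Subtype.ext
    have this : (x.1 ∘ e) ∘ e.symm = (y.1 ∘ e) ∘ e.symm := congrArg (fun ζ => ζ ∘ e.symm) h2
    rwa [hc, hc] at this
  · intro x
    obtain ⟨ht, hflip⟩ := hmem ⟨x.1 ∘ e, (mem_tgtU_comp_equiv ends e x.1).1 x.2⟩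
    refine ⟨?_, ?_⟩
    · rw [mem_tgtU_comp_equiv ends e, hc']
      exact ht
    · intro g hg hred
      rw [cluster_comp_equiv ends e x.1 h, mem_within_comp_equiv ends e] at hg
      have hred' : (x.1 ∘ e) (e.symm g) = true := by
        show x.1 (e (e.symm g)) = true
        rw [Equiv.apply_symm_apply]; exact hred
      exact hflip (e.symm g) hg hred'

end Equiv

/-! ## The block reduction -/

/-- Row 2′SW-ALL on every multigraph without a cut vertex. -/
def SwAllNoCut : Prop :=
  ∀ (V E : Type) [Fintype V] [DecidableEq V] [Fintype E] [DecidableEq E] (ends : E → Sym2 V),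
    (¬ ∃ (c : V) (V₁ V₂ : Set V), HasCut ends c V₁ V₂) →
      ∀ l h o : V, l ≠ h → o ≠ l → o ≠ h → SwAll ends l h o

/-- **The rigid block reduction**: row 2′SW-ALL on the multigraphs without a cut vertex gives row
2′SW-ALL on every finite multigraph. -/
theorem swAll_all_of_noCut (hbase : SwAllNoCut) : SwAll_all := by
  suffices key : ∀ n : ℕ, ∀ (V E : Type) [Fintype V] [DecidableEq V] [Fintype E] [DecidableEq E]
      (ends : E → Sym2 V), Fintype.card E = n →
        ∀ l h o : V, l ≠ h → o ≠ l → o ≠ h → SwAll ends l h o by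
    intro V E _ _ _ _ ends l h o hlh hol hoh
    exact key _ V E ends rfl l h o hlh hol hoh
  intro n
  induction n using Nat.strong_induction_on with
  | _ n ih =>
    intro V E _ _ _ _ ends hn l h o hlh hol hoh
    by_cases hcut : ∃ (c : V) (V₁ V₂ : Set V), HasCut ends c V₁ V₂
    · obtain ⟨c, V₁, V₂, hc⟩ := hcut
      have h₁ : Fintype.card (sideE₁ ends V₁) < n := by
        rw [← hn]
        obtain ⟨e, he⟩ := hc.edge₂
        exact Fintype.card_subtype_lt (x := e) he
      have h₂ : Fintype.card (sideE₂ ends V₁) < n := by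
        rw [← hn]
        obtain ⟨e, he⟩ := hc.edge₁
        have he' : ∀ x ∈ ends e, x ∈ V₁ := by
          rcases hc.side e with h | h
          · exact h
          · exact absurd h he
        exact Fintype.card_subtype_lt (x := e) (not_not.2 he')
      have hs₁ : ∀ l h o : V, l ≠ h → o ≠ l → o ≠ h → SwAll (ends₁ ends V₁) l h o :=
        ih _ h₁ V (sideE₁ ends V₁) (ends₁ ends V₁) rfl
      have hs₂ : ∀ l h o : V, l ≠ h → o ≠ l → o ≠ h → SwAll (ends₂ ends V₁) l h o :=
        ih _ h₂ V (sideE₂ ends V₁) (ends₂ ends V₁) rfl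
      have hglue := swAll_glue_of_sides hc.isGluing hs₁ hs₂ hlh hol hoh (hc.cover l) (hc.cover h)
        (hc.cover o)
      rw [glue_sides_eq] at hglue
      exact swAll_of_equiv ends _ hglue
    · exact hbase V E ends hcut l h o hlh hol hoh

/-- **The weight-free base through the rigid row**: row (SW) on every finite multigraph follows from
the rigid row 2′SW-ALL on the multigraphs without a cut vertex. -/
theorem sw_all_of_swAllNoCut (hbase : SwAllNoCut) : Sw_all :=
  sw_all_of_swAll_all (swAll_all_of_noCut hbase)

end Glue

end Summit.Ventures.PercRepro2
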